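import Summits.CriticalPhenomena.CardyFormulaZ2.Theorems.CardyFlipRussoJitteredTriangularLegCardy

/-!
# `JitteredTriangularLeg`: the residual after the `σ = 0` slice

Helper file for the support item `JitteredTriangularLeg` (stmt-CriticalPhenomena-6436) of route
`CardyFlipRusso`: with Smirnov's theorem (`hasCrossingLimit_triDomainCrossingProb_holds`) and the
`σ = 0` slice (`jitteredTriangularLeg_sigma_zero`, `CardyFlipRussoJitteredTriangularLegCardy.lean`)
proved, the item is equivalent to its `σ > 0` part (`jitteredTriangularLeg_iff_pos`): Cardy's
formula for the annealed Voronoi percolation of the jittered triangular lattice at every positive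
jitter — crossing universality off the triangular site model, an open problem (Beffara 2008
§2.2/§4.2; Benjamini–Schramm 1998; Grimmett, Proc. ICM 2014, §5(B)); `jitteredTriangularLeg_of_pos`
records the implication that would close the item.
-/

noncomputable section

open MeasureTheory Set Metric

namespace Summit.CriticalPhenomena.CardyFormulaZ2.Theorems

open Literature.Probability.Percolation Literature.Probability.LatticeModels
  Literature.Probability.RandomPlanarGeometry

/-! ### The residual of the item: only `σ > 0` remains -/

section Residual

/-- **`JitteredTriangularLeg` reduces to its `σ > 0` part.** With Smirnov's theorem proved in the
tree (the antecedent) and the `σ = 0` slice proved (`jitteredTriangularLeg_sigma_zero`), the route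
item stmt-CriticalPhenomena-6436 is equivalent to Cardy's formula for the annealed Voronoi
percolation of the jittered triangular lattice for every POSITIVE jitter `σ > 0` — an instance of
crossing universality off the triangular site model, open (Beffara 2008 §2.2; Benjamini–Schramm
1998; Grimmett, Proc. ICM 2014 §5(B)). [folklore] -/
theorem jitteredTriangularLeg_iff_pos :
    Summit.CriticalPhenomena.CardyFormulaZ2.Theses.CardyFlipRusso.JitteredTriangularLeg ↔
    ∀ σ : ℝ, 0 < σ → ∀ R : ConformalRectangle,
      R.HasCrossingLimit (fun δ ↦ ((Measure.infinitePi (fun _ : Site 2 ↦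
        (ProbabilityTheory.gaussianReal 0 1).prod (ProbabilityTheory.gaussianReal 0 1))).prod
          (sitePercolation (Site 2) half)).real
        {p | voronoiCrossing R.carrier (R.arc 0) (R.arc 2) δ
          ((fun v ↦ triEmbed v + (σ : ℂ) * ((p.1 v).1 + (p.1 v).2 * Complex.I)) '' p.2)
          ((fun v ↦ triEmbed v + (σ : ℂ) * ((p.1 v).1 + (p.1 v).2 * Complex.I)) '' (p.2)ᶜ)})
        Literature.Probability.RandomPlanarGeometry.cardyFunction := by
  rw [jitteredTriangularLeg_iff]
  constructor
  · intro h σ hσ R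
    exact h hasCrossingLimit_triDomainCrossingProb_holds σ hσ.le R
  · intro h _ σ hσ R
    rcases hσ.lt_or_eq with hσ | rfl
    · exact h σ hσ R
    · exact jitteredTriangularLeg_sigma_zero R

/-- **The item from crossing universality at positive jitter**: if Cardy's formula holds for the
jittered triangular lattice at every `σ > 0`, then `JitteredTriangularLeg` holds (the `σ = 0`
endpoint and the antecedent being theorems). [folklore] -/
theorem jitteredTriangularLeg_of_pos
    (h : ∀ σ : ℝ, 0 < σ → ∀ R : ConformalRectangle,
      R.HasCrossingLimit (fun δ ↦ ((Measure.infinitePi (fun _ : Site 2 ↦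
        (ProbabilityTheory.gaussianReal 0 1).prod (ProbabilityTheory.gaussianReal 0 1))).prod
          (sitePercolation (Site 2) half)).real
        {p | voronoiCrossing R.carrier (R.arc 0) (R.arc 2) δ
          ((fun v ↦ triEmbed v + (σ : ℂ) * ((p.1 v).1 + (p.1 v).2 * Complex.I)) '' p.2)
          ((fun v ↦ triEmbed v + (σ : ℂ) * ((p.1 v).1 + (p.1 v).2 * Complex.I)) '' (p.2)ᶜ)})
        Literature.Probability.RandomPlanarGeometry.cardyFunction) :
    Summit.CriticalPhenomena.CardyFormulaZ2.Theses.CardyFlipRusso.JitteredTriangularLeg :=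
  jitteredTriangularLeg_iff_pos.2 h

end Residual

end Summit.CriticalPhenomena.CardyFormulaZ2.Theorems

end
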